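import Literature.NumberTheory.LFunctions.Zhang2022.RepairIntakeBmulti
import Literature.NumberTheory.LFunctions.Zhang2022.RepairLambdaBlock

/-!
# Zhang (2022), repair rung F-S3 §E KILL-INTAKE of B-multi (S-E-p3-4 glue piece): the twelve BATCH-1 members of
# `K_multi` as terms of the intake's design types, with their memberships PROVED

Y. Zhang, *Discrete mean estimates and the Landau–Siegel zero*, arXiv:2211.02515v1 [Zhang2022LandauSiegel] — an
unrefereed manuscript under adjudication; NOTHING here asserts any of its claims and nothing here is a statement
about Landau–Siegel zeros. Cell `landau-siegel`, §E KILL-INTAKE of family B-multi (director's KILL word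
2026-08-26T18:10:26Z, KILL-CERT v2.4 96c2304f42278a63; intake file `RepairIntakeBmulti.lean` = the union design type
`Repair.BmultiDesign` (v1) … `BmultiDesign5` (v5) with membership `KBmulti…` and `familyBmulti…_decided`).

**What this file does (pure glue, D-0064 one module):** for each member of B-multi's design batch
`B-multi/designs/BATCH-1.json` (index `designs/INDEX.md`; member ↦ sub-class join = `B-multi/INTAKE-COVERAGE.md`
v1.4 §1) it defines the member as a term of the intake type — the constructor of its sub-class carrying the design's
LITERAL profile data in the tree's vocabulary (`Repair.kappaP ν k` = the `ϰ_{ν,k}` profile of (2.23)–(2.25),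
`afeDir 2` = the kernel mode `e^{−2πiz}`, `KnifeEdge.WallData.flat/ramp/sharpCut`, `KnifeEdge.JumpData`,
`Repair.LambdaDesign`, `Repair.FarBVData`) — and PROVES its membership `KBmulti…`. New analysis: the generic
«`ϰ`-piece cut at an interior height with its jump removed» profile `kappaCutCont ν k z₀` is a one-sided kinked
profile (`kinkedProfile_kappaCutCont`) — this is how a truncated smooth piece `ϰ·𝟙_{[0,z₀)}` becomes an M1 jump
datum `cont + η·𝟙_{[0,z₀)}` with `η = ϰ(z₀)` (the design's literal left limit); and `kinkedProfile_afeDir`.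

| member | sub-class ↦ constructor | term | membership |
|---|---|---|---|
| multi-sanity-001 | M4/θ₀ glue ↦ `m4` | `member_sanity001 = .m4 theta0` | `kbmulti_sanity001` |
| multi-sanity-002 | M0 ↦ `m0` (g(1) = f(1) = 0) | side 1 `ϰ(63/125,3/2)+ϰ(1/2,5/2)+ϰ(9/20,2)`, side 2 `ϰ(249/500,3/2)+ϰ(1/2,5/2)` | `kbmulti_sanity002` |
| multi-jump-001 | M1 ↦ `m1 κ J` | side-2 profile `ϰ(249/500,3/2) + ϰ(1/2,5/2)𝟙_{[0,9/20)}`: `jump001` (jump `η = ϰ_{1/2,5/2}(9/20)` at `9/20`) | `kbmulti_jump001` |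
| multi-jump-002 | M1 | side-1 profile `ϰ(1/2,5/2) + ϰ(63/125,3/2)𝟙_{[0,2/5)}`: `jump002` (`η = ϰ_{63/125,3/2}(2/5)` at `2/5`) | `kbmulti_jump002` |
| multi-jump-003 | M1 | p4's `Repair.jumpBPRZ` verbatim (`RepairJumpBlock.lean`) | `kbmulti_jump003` |
| multi-wall-001 | M3-wall ↦ `m3wall` | bulk `ϰ(1,5/2)`, band `W` (plateau `flat c` / ramp `ramp c` / wall-value-only `sharpCut`) | `kbmulti_wall001` |
| multi-wall-002 | M3-wall | bulk `ϰ(21/20,5/2)∣[0,1]` (`u(1⁻) = 1/21 ≠ 0`), `W` ∈ {`sharpCut`, `flat (ϰ(1))` (= p3's `inClass_wall002`), `ramp (ϰ(1))`, `flat c`} | `kbmulti_wall002` |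
| multi-wall-003 | M3-wall | bulk `afeDir 2` (`|u(1⁻)| = 1`, `𝔅 = 0`), band `W` | `kbmulti_wall003` |
| multi-wall-004 | M3-wall | bulk `ϰ(1,3/2) + ϰ(1/2,5/2)`, band `W` | `kbmulti_wall004` |
| multi-far-001 | (L-a.iii) ↦ `BmultiDesign4.farBV` | p4's `farBlock`-type datum (`RepairFarBV.lean`): `member_far001 c'` = `⟨c', 1, 1/4, 1, 2, farBlock⟩`; the literal bulk `i·ϰ(1,5/2)` vanishes on `[1,2]` and does not enter the family's currency (variation beyond the wall) — declared narrowing: block height `1` for the literal `1/2` (homogeneity) | `kbmulti_far001` |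
| multi-lambda-001/002 | M2 ↦ `familyLambdaBlockAll` (intake v5 constructor `m2`) | p5's `Repair.lambdaDesignFeng1/2 c` (bulk `ϰ(63/125,3/2)`, pieces `lambdaPieceFeng1/2`; `RepairLambdaBlock.lean`) and the literal two-piece bulk variant `lambda001Design c` (bulk `ϰ(63/125,3/2) + ϰ(1/2,5/2)`) | `kbmulti_lambda001/002`, `kbmulti_lambda001_lit` |

Readings declared (C1 honesty): jump heights and band/Λ amplitudes enter the families in the BALANCED reading (the
literal fixed-height reading of M1/M3 is typed nowhere — INTAKE-COVERAGE §1); the M1 datum carries the side with the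
jump (the other side is a smooth in-class piece and belongs to the free-`ι` Gram bookkeeping, not to the M1 currency);
sanity-002's free-`ι` five-piece design is entered at `ι ≡ 1` per side (any other `ι` is the same constructor with
`KinkedProfile.add_smul`). [cite: Zhang2022LandauSiegel, (2.23)–(2.25), §2 (2.32)–(2.33), §7 Prop 7.1 (7.2)]
«The programme SEARCHES and TYPES; no claim about Landau–Siegel zeros, Theorems 1–2 of arXiv:2211.02515 or a
repaired Margin232 until a kernel theorem says so.»
-/

noncomputable section

open Complex Real Set
open _root_.MeasureTheory

namespace Literature.NumberTheory.LFunctions.Zhang2022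

namespace Repair

open KnifeEdge

/-! ### Part 0 — two profile lemmas: a `ϰ`-piece cut at an interior height, and the kernel mode -/

section Profiles

variable {ν k z₀ : ℝ}

/-- **A `ϰ`-piece cut at `z₀` with its jump removed:** `ϰ_{ν,k}(min(y,z₀)) − ϰ_{ν,k}(z₀)`, i.e. `ϰ(y) − ϰ(z₀)` for
`y < z₀` and `0` for `y ≥ z₀` — continuous; `kappaCutCont + ϰ(z₀)·𝟙_{[0,z₀)} = ϰ·𝟙_{[0,z₀)}` on `[0,∞)`.
[cite: Zhang2022LandauSiegel, (2.23)–(2.25); §7 (7.2)] -/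
def kappaCutCont (ν k z₀ : ℝ) (y : ℝ) : ℂ := kappaP ν k (min y z₀) - kappaP ν k z₀

/-- Its marked right derivative: `ϰ′_{ν,k}` below the cut, `0` from the cut on.
[cite: Zhang2022LandauSiegel, (2.23)–(2.25)] -/
def kappaCutCont' (ν k z₀ : ℝ) : ℝ → ℂ := (Iio z₀).indicator (kappaP' ν k)

/-- Below the cut. [cite: Zhang2022LandauSiegel, (2.23)–(2.25)] -/
theorem kappaCutCont_of_lt {y : ℝ} (hy : y < z₀) : kappaCutCont ν k z₀ y = kappaP ν k y - kappaP ν k z₀ := by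
  rw [kappaCutCont, min_eq_left hy.le]

/-- From the cut on. [cite: Zhang2022LandauSiegel, (2.23)–(2.25)] -/
theorem kappaCutCont_of_ge {y : ℝ} (hy : z₀ ≤ y) : kappaCutCont ν k z₀ y = 0 := by
  rw [kappaCutCont, min_eq_right hy, sub_self]

/-- The cut profile plus its literal jump IS the truncated piece: for `0 ≤ y`,
`kappaCutCont y + ϰ(z₀)·𝟙_{[0,z₀)}(y) = ϰ(y)` if `y < z₀`, `= 0` otherwise. [cite: Zhang2022LandauSiegel, (2.23)–(2.25); §7 (7.2)] -/
theorem kappaCutCont_add_step {y : ℝ} (hy : 0 ≤ y) :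
    kappaCutCont ν k z₀ y + kappaP ν k z₀ * stepFun z₀ y = if y < z₀ then kappaP ν k y else 0 := by
  by_cases h : y < z₀
  · rw [if_pos h, kappaCutCont_of_lt h, stepFun_of_mem ⟨hy, h⟩]; ring
  · rw [if_neg h, kappaCutCont_of_ge (not_lt.1 h), stepFun_of_not_mem (fun hm => h hm.2)]; ring

/-- **The cut profile is a one-sided kinked profile** (`0 < z₀ < 1`, `0 < ν ≤ 1`): continuous on `[0,1]` (the two
branches agree at the cut), right derivative `ϰ′` below the cut and `0` beyond, square-integrable.
[cite: Zhang2022LandauSiegel, (2.23)–(2.25); §7 Prop 7.1 (7.2)] -/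
theorem kinkedProfile_kappaCutCont (hν : 0 < ν) (hν1 : ν ≤ 1) (hz : 0 < z₀) :
    KinkedProfile (kappaCutCont ν k z₀) (kappaCutCont' ν k z₀) where
  cont := by
    have hκ := (kinkedProfile_kappaP (k := k) hν hν1).cont
    have hmin : ContinuousOn (fun y : ℝ => min y z₀) (Icc 0 1) := (continuous_id.min continuous_const).continuousOn
    have hmaps : MapsTo (fun y : ℝ => min y z₀) (Icc 0 1) (Icc 0 1) := by
      intro y hy
      exact ⟨le_min hy.1 hz.le, (min_le_left _ _).trans hy.2⟩
    exact (hκ.comp hmin hmaps).sub continuousOn_const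
  hasDeriv := by
    intro x hx
    have hκ := kinkedProfile_kappaP (k := k) hν hν1
    by_cases hcut : x < z₀
    · -- below the cut: locally `ϰ − ϰ(z₀)`
      have hd : HasDerivWithinAt (fun y => kappaP ν k y - kappaP ν k z₀) (kappaP' ν k x) (Ioi x) x :=
        (hκ.hasDeriv x hx).sub_const _
      have hev : kappaCutCont ν k z₀ =ᶠ[nhdsWithin x (Ioi x)] fun y => kappaP ν k y - kappaP ν k z₀ := by
        have h1 : ∀ᶠ y in nhds x, kappaCutCont ν k z₀ y = kappaP ν k y - kappaP ν k z₀ := by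
          filter_upwards [Iio_mem_nhds hcut] with y hy using kappaCutCont_of_lt hy
        exact h1.filter_mono nhdsWithin_le_nhds
      have hval : kappaCutCont' ν k z₀ x = kappaP' ν k x := Set.indicator_of_mem (by exact hcut) _
      rw [hval]
      exact hd.congr_of_eventuallyEq hev (kappaCutCont_of_lt hcut)
    · -- from the cut on: identically `0` to the right
      replace hcut : z₀ ≤ x := not_lt.1 hcut
      have hval : kappaCutCont' ν k z₀ x = 0 := Set.indicator_of_notMem (by exact not_lt.2 hcut) _
      rw [hval]
      refine (hasDerivWithinAt_const x (Ioi x) (0:ℂ)).congr (fun y hy => ?_) ?_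
      · exact kappaCutCont_of_ge (hcut.trans (le_of_lt hy))
      · exact kappaCutCont_of_ge hcut
  memLp := ((kinkedProfile_kappaP (k := k) hν hν1).memLp).indicator measurableSet_Iio

/-- `kappaCutCont` vanishes at the wall (`z₀ ≤ 1`). [cite: Zhang2022LandauSiegel, (2.23)–(2.25)] -/
theorem kappaCutCont_one (hz1 : z₀ ≤ 1) : kappaCutCont ν k z₀ 1 = 0 := kappaCutCont_of_ge hz1

/-- **The kernel mode `e^{−iπjy}` is a one-sided kinked profile** (entire; derivative `afeDir'`).
[cite: Zhang2022LandauSiegel, §7 Prop 7.1 (7.2)] -/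
theorem kinkedProfile_afeDir (j : ℕ) : KinkedProfile (afeDir j) (afeDir' j) where
  cont := (continuous_afeDir j).continuousOn
  hasDeriv := fun x _ => (hasDerivAt_afeDir j x).hasDerivWithinAt
  memLp := by
    have hc : Continuous (afeDir' j) := by unfold afeDir'; exact continuous_const.mul (continuous_afeDir j)
    refine MemLp.of_bound hc.aestronglyMeasurable ((j : ℝ) * π) (Filter.Eventually.of_forall fun y => ?_)
    rw [afeDir', norm_mul, norm_afeDir, mul_one, afeFreq, norm_neg, norm_mul, norm_mul, Complex.norm_I, mul_one,
      Complex.norm_real, Complex.norm_natCast, Real.norm_eq_abs, abs_of_pos Real.pi_pos]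

end Profiles

/-! ### Part 1 — M4 / M0: the two sanity members -/

/-- **multi-sanity-001** (Zhang's `θ₀` glue re-read as a member): `m4 θ₀`. [cite: Zhang2022LandauSiegel, §2 (2.32)–(2.33)] -/
def member_sanity001 : BmultiDesign := .m4 theta0

/-- … is a member (`admissible_theta0`). [cite: Zhang2022LandauSiegel, §2 (2.32)–(2.33)] -/
theorem kbmulti_sanity001 : KBmulti member_sanity001 := kbmulti_m4_of_admissible admissible_theta0

/-- multi-sanity-002, side 1 at `ι ≡ 1`: `ϰ(63/125,3/2) + ϰ(1/2,5/2) + ϰ(9/20,2)`. [cite: Zhang2022LandauSiegel, (2.23)–(2.25)] -/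
def sanity002Side1 (y : ℝ) : ℂ := kappaP (63 / 125) (3 / 2) y + kappaP (1 / 2) (5 / 2) y + kappaP (9 / 20) 2 y

/-- its marked right derivative. [cite: Zhang2022LandauSiegel, (2.23)–(2.25)] -/
def sanity002Side1' (y : ℝ) : ℂ := kappaP' (63 / 125) (3 / 2) y + kappaP' (1 / 2) (5 / 2) y + kappaP' (9 / 20) 2 y

/-- multi-sanity-002, side 2 at `ι ≡ 1`: `ϰ(249/500,3/2) + ϰ(1/2,5/2)`. [cite: Zhang2022LandauSiegel, (2.23)–(2.25)] -/
def sanity002Side2 (y : ℝ) : ℂ := kappaP (249 / 500) (3 / 2) y + kappaP (1 / 2) (5 / 2) y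

/-- its marked right derivative. [cite: Zhang2022LandauSiegel, (2.23)–(2.25)] -/
def sanity002Side2' (y : ℝ) : ℂ := kappaP' (249 / 500) (3 / 2) y + kappaP' (1 / 2) (5 / 2) y

/-- Side 1 is kinked. [cite: Zhang2022LandauSiegel, (2.23)–(2.25); §7 Prop 7.1 (7.2)] -/
theorem kinkedProfile_sanity002Side1 : KinkedProfile sanity002Side1 sanity002Side1' := by
  have h1 := kinkedProfile_kappaP (k := 3 / 2) (ν := 63 / 125) (by norm_num) (by norm_num)
  have h2 := kinkedProfile_kappaP (k := 5 / 2) (ν := 1 / 2) (by norm_num) (by norm_num)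
  have h3 := kinkedProfile_kappaP (k := 2) (ν := 9 / 20) (by norm_num) (by norm_num)
  have h := (h1.add_smul h2 1).add_smul h3 1
  show KinkedProfile
    (fun y => kappaP (63 / 125) (3 / 2) y + kappaP (1 / 2) (5 / 2) y + kappaP (9 / 20) 2 y)
    (fun y => kappaP' (63 / 125) (3 / 2) y + kappaP' (1 / 2) (5 / 2) y + kappaP' (9 / 20) 2 y)
  simpa only [one_mul] using h

/-- Side 2 is kinked. [cite: Zhang2022LandauSiegel, (2.23)–(2.25); §7 Prop 7.1 (7.2)] -/
theorem kinkedProfile_sanity002Side2 : KinkedProfile sanity002Side2 sanity002Side2' := by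
  have h1 := kinkedProfile_kappaP (k := 3 / 2) (ν := 249 / 500) (by norm_num) (by norm_num)
  have h2 := kinkedProfile_kappaP (k := 5 / 2) (ν := 1 / 2) (by norm_num) (by norm_num)
  show KinkedProfile (fun y => kappaP (249 / 500) (3 / 2) y + kappaP (1 / 2) (5 / 2) y)
    (fun y => kappaP' (249 / 500) (3 / 2) y + kappaP' (1 / 2) (5 / 2) y)
  simpa only [one_mul] using h1.add_smul h2 1

/-- **multi-sanity-002** (M0: multi-piece `H¹` bulk on both sides, tops `≤ 1`, wall values `0`).
[cite: Zhang2022LandauSiegel, §2 (2.32)–(2.33)] -/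
def member_sanity002 : BmultiDesign := .m0 sanity002Side1 sanity002Side1' sanity002Side2 sanity002Side2'

/-- … is a member (guard G1 `g(1) = f(1) = 0` by `kappaP_one`). [cite: Zhang2022LandauSiegel, §2 (2.32)–(2.33)] -/
theorem kbmulti_sanity002 : KBmulti member_sanity002 := by
  refine kbmulti_m0_of_kinked kinkedProfile_sanity002Side1 kinkedProfile_sanity002Side2 ?_ ?_
  · show kappaP (63 / 125) (3 / 2) 1 + kappaP (1 / 2) (5 / 2) 1 + kappaP (9 / 20) 2 1 = 0
    rw [kappaP_one (by norm_num) (by norm_num), kappaP_one (by norm_num) (by norm_num),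
      kappaP_one (by norm_num) (by norm_num), add_zero, add_zero]
  · show kappaP (249 / 500) (3 / 2) 1 + kappaP (1 / 2) (5 / 2) 1 = 0
    rw [kappaP_one (by norm_num) (by norm_num), kappaP_one (by norm_num) (by norm_num), add_zero]

/-! ### Part 2 — M1: the three interior-jump members -/

/-- multi-jump-001's jumped side (side 2): continuous part `ϰ(249/500,3/2) + kappaCutCont(1/2,5/2; 9/20)`.
[cite: Zhang2022LandauSiegel, (2.23)–(2.25); §7 (7.2)] -/
def jump001Cont (y : ℝ) : ℂ := kappaP (249 / 500) (3 / 2) y + kappaCutCont (1 / 2) (5 / 2) (9 / 20) y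

/-- its marked right derivative. [cite: Zhang2022LandauSiegel, (2.23)–(2.25)] -/
def jump001Cont' (y : ℝ) : ℂ := kappaP' (249 / 500) (3 / 2) y + kappaCutCont' (1 / 2) (5 / 2) (9 / 20) y

/-- **multi-jump-001 as a jump datum:** `cont = jump001Cont`, ONE jump at `9/20` of literal height
`η = ϰ_{1/2,5/2}(9/20)` (`= (1/10)e^{iπ/8}`), so that `J.profile 1 = ϰ(249/500,3/2) + ϰ(1/2,5/2)𝟙_{[0,9/20)}` on `[0,∞)`.
[cite: Zhang2022LandauSiegel, (2.23)–(2.25); §7 (7.2)] -/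
def jump001 : JumpData where
  n := 1
  cont := jump001Cont
  cont' := jump001Cont'
  pos := fun _ => 9 / 20
  coef := fun _ => kappaP (1 / 2) (5 / 2) (9 / 20)

/-- `jump001` is admissible. [cite: Zhang2022LandauSiegel, §7 Prop 7.1 (7.2)] -/
theorem admissible_jump001 : jump001.Admissible where
  kinked := by
    have h1 := kinkedProfile_kappaP (k := 3 / 2) (ν := 249 / 500) (by norm_num) (by norm_num)
    have h2 := kinkedProfile_kappaCutCont (k := 5 / 2) (ν := 1 / 2) (z₀ := 9 / 20)
      (by norm_num) (by norm_num) (by norm_num)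
    show KinkedProfile (fun y => kappaP (249 / 500) (3 / 2) y + kappaCutCont (1 / 2) (5 / 2) (9 / 20) y)
      (fun y => kappaP' (249 / 500) (3 / 2) y + kappaCutCont' (1 / 2) (5 / 2) (9 / 20) y)
    simpa only [one_mul] using h1.add_smul h2 1
  top := by
    change jump001Cont 1 = 0
    rw [jump001Cont, kappaP_one (by norm_num) (by norm_num), kappaCutCont_one (by norm_num), add_zero]
  interior := fun _ => by change (9 / 20 : ℝ) ∈ Ioo (0:ℝ) 1; constructor <;> norm_num

/-- The balanced profile of `jump001` at scale `1` is the design's side 2 literally (`0 ≤ z`).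
[cite: Zhang2022LandauSiegel, (2.23)–(2.25); §7 (7.2)] -/
theorem jump001_profile_one {z : ℝ} (hz : 0 ≤ z) :
    jump001.profile 1 z = kappaP (249 / 500) (3 / 2) z + if z < 9 / 20 then kappaP (1 / 2) (5 / 2) z else 0 := by
  unfold JumpData.profile jump001
  simp only [Finset.univ_unique, Fin.default_eq_zero, Finset.sum_singleton, Real.sqrt_one, inv_one,
    Complex.ofReal_one, mul_one]
  rw [jump001Cont, add_assoc, kappaCutCont_add_step hz]

/-- **multi-jump-001** (M1; kernel coordinate `κ` free, as in `familyJumpBlockAll`). [cite: Zhang2022LandauSiegel, §7 (7.2)] -/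
def member_jump001 (κ : ℝ → ℝ) : BmultiDesign := .m1 κ jump001

/-- … is a member. [cite: Zhang2022LandauSiegel, §7 Prop 7.1 (7.2)] -/
theorem kbmulti_jump001 (κ : ℝ → ℝ) : KBmulti (member_jump001 κ) := admissible_jump001

/-- multi-jump-002's jumped side (side 1): `ϰ(1/2,5/2) + kappaCutCont(63/125,3/2; 2/5)`.
[cite: Zhang2022LandauSiegel, (2.23)–(2.25); §7 (7.2)] -/
def jump002Cont (y : ℝ) : ℂ := kappaP (1 / 2) (5 / 2) y + kappaCutCont (63 / 125) (3 / 2) (2 / 5) y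

/-- its marked right derivative. [cite: Zhang2022LandauSiegel, (2.23)–(2.25)] -/
def jump002Cont' (y : ℝ) : ℂ := kappaP' (1 / 2) (5 / 2) y + kappaCutCont' (63 / 125) (3 / 2) (2 / 5) y

/-- **multi-jump-002 as a jump datum:** ONE jump at `2/5` of literal height `η = ϰ_{63/125,3/2}(2/5)` (`|η| = 13/63`).
[cite: Zhang2022LandauSiegel, (2.23)–(2.25); §7 (7.2)] -/
def jump002 : JumpData where
  n := 1
  cont := jump002Cont
  cont' := jump002Cont'
  pos := fun _ => 2 / 5
  coef := fun _ => kappaP (63 / 125) (3 / 2) (2 / 5)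

/-- `jump002` is admissible. [cite: Zhang2022LandauSiegel, §7 Prop 7.1 (7.2)] -/
theorem admissible_jump002 : jump002.Admissible where
  kinked := by
    have h1 := kinkedProfile_kappaP (k := 5 / 2) (ν := 1 / 2) (by norm_num) (by norm_num)
    have h2 := kinkedProfile_kappaCutCont (k := 3 / 2) (ν := 63 / 125) (z₀ := 2 / 5)
      (by norm_num) (by norm_num) (by norm_num)
    show KinkedProfile (fun y => kappaP (1 / 2) (5 / 2) y + kappaCutCont (63 / 125) (3 / 2) (2 / 5) y)
      (fun y => kappaP' (1 / 2) (5 / 2) y + kappaCutCont' (63 / 125) (3 / 2) (2 / 5) y)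
    simpa only [one_mul] using h1.add_smul h2 1
  top := by
    change jump002Cont 1 = 0
    rw [jump002Cont, kappaP_one (by norm_num) (by norm_num), kappaCutCont_one (by norm_num), add_zero]
  interior := fun _ => by change (2 / 5 : ℝ) ∈ Ioo (0:ℝ) 1; constructor <;> norm_num

/-- The balanced profile of `jump002` at scale `1` is the design's side 1 literally (`0 ≤ z`).
[cite: Zhang2022LandauSiegel, (2.23)–(2.25); §7 (7.2)] -/
theorem jump002_profile_one {z : ℝ} (hz : 0 ≤ z) :
    jump002.profile 1 z = kappaP (1 / 2) (5 / 2) z + if z < 2 / 5 then kappaP (63 / 125) (3 / 2) z else 0 := by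
  unfold JumpData.profile jump002
  simp only [Finset.univ_unique, Fin.default_eq_zero, Finset.sum_singleton, Real.sqrt_one, inv_one,
    Complex.ofReal_one, mul_one]
  rw [jump002Cont, add_assoc, kappaCutCont_add_step hz]

/-- **multi-jump-002** (M1). [cite: Zhang2022LandauSiegel, §7 (7.2)] -/
def member_jump002 (κ : ℝ → ℝ) : BmultiDesign := .m1 κ jump002

/-- … is a member. [cite: Zhang2022LandauSiegel, §7 Prop 7.1 (7.2)] -/
theorem kbmulti_jump002 (κ : ℝ → ℝ) : KBmulti (member_jump002 κ) := admissible_jump002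

/-- **multi-jump-003** (M1, the BPRZ archetype) = p4's `jumpBPRZ` verbatim. [cite: Zhang2022LandauSiegel, §7 (7.2)] -/
def member_jump003 (κ : ℝ → ℝ) : BmultiDesign := .m1 κ jumpBPRZ

/-- … is a member (`admissible_jumpBPRZ`). [cite: Zhang2022LandauSiegel, §7 Prop 7.1 (7.2)] -/
theorem kbmulti_jump003 (κ : ℝ → ℝ) : KBmulti (member_jump003 κ) := admissible_jumpBPRZ

/-! ### Part 3 — M3-wall: the four wall/band members (band datum `W` = the design's variant coordinate) -/

/-- **multi-wall-001**: bulk `u₁ = ϰ(1,5/2)` (control-one piece, `u(1) = 0`) with band datum `W`.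
[cite: Zhang2022LandauSiegel, (2.23)–(2.25); §2 (2.30)] -/
def member_wall001 (W : WallData) : BmultiDesign := .m3wall (kappaP 1 (5 / 2)) (kappaP' 1 (5 / 2)) W

/-- … is a member for every band datum. [cite: Zhang2022LandauSiegel, §7 Prop 7.1 (7.2)] -/
theorem kbmulti_wall001 (W : WallData) : KBmulti (member_wall001 W) :=
  kinkedProfile_kappaP (by norm_num) le_rfl

/-- its three printed variants: plateau `flat c`, ramp `ramp c`, wall-value-only `sharpCut` (`c ∈ {1/2, 1, 2}`).
[cite: Zhang2022LandauSiegel, §2 (2.30)] -/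
theorem kbmulti_wall001_variants (c : ℂ) :
    KBmulti (member_wall001 (WallData.flat c)) ∧ KBmulti (member_wall001 (WallData.ramp c)) ∧
      KBmulti (member_wall001 WallData.sharpCut) :=
  ⟨kbmulti_wall001 _, kbmulti_wall001 _, kbmulti_wall001 _⟩

/-- **multi-wall-002**: bulk `u₂ = ϰ(21/20,5/2)∣[0,1]` (wall value `1/21 ≠ 0`) with band datum `W`
(literal-cut `sharpCut`, literal-plateau `flat (u₂(1))` = p3's `inClass_wall002`, literal-ramp `ramp (u₂(1))`,
balanced-plateau `flat c`). [cite: Zhang2022LandauSiegel, (2.23)–(2.25); §2 (2.30)] -/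
def member_wall002 (W : WallData) : BmultiDesign := .m3wall (kappaP (21 / 20) (5 / 2)) (kappaP' (21 / 20) (5 / 2)) W

/-- … is a member for every band datum (`kinkedProfile_kappaP_long`), and its wall value is `≠ 0`.
[cite: Zhang2022LandauSiegel, §7 Prop 7.1 (7.2)] -/
theorem kbmulti_wall002 (W : WallData) : KBmulti (member_wall002 W) ∧ kappaP (21 / 20) (5 / 2) 1 ≠ 0 :=
  ⟨kinkedProfile_kappaP_long (by norm_num), kappaP_one_ne_zero (by norm_num)⟩

/-- **multi-wall-003**: bulk `u₃ = e^{−2πiz}` = `afeDir 2` (kernel mode, `𝔅(u₃) = 0`, `|u₃(1⁻)| = 1`) with band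
datum `W`. [cite: Zhang2022LandauSiegel, §7 Prop 7.1 (7.2)] -/
def member_wall003 (W : WallData) : BmultiDesign := .m3wall (afeDir 2) (afeDir' 2) W

/-- … is a member for every band datum. [cite: Zhang2022LandauSiegel, §7 Prop 7.1 (7.2)] -/
theorem kbmulti_wall003 (W : WallData) : KBmulti (member_wall003 W) := kinkedProfile_afeDir 2

/-- multi-wall-004's bulk (side 1 at `ι ≡ 1`): `ϰ(1,3/2) + ϰ(1/2,5/2)`. [cite: Zhang2022LandauSiegel, (2.23)–(2.25)] -/
def wall004Bulk (y : ℝ) : ℂ := kappaP 1 (3 / 2) y + kappaP (1 / 2) (5 / 2) y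

/-- its marked right derivative. [cite: Zhang2022LandauSiegel, (2.23)–(2.25)] -/
def wall004Bulk' (y : ℝ) : ℂ := kappaP' 1 (3 / 2) y + kappaP' (1 / 2) (5 / 2) y

/-- **multi-wall-004**: bulk `ϰ(1,3/2) + ϰ(1/2,5/2)` with band datum `W`. [cite: Zhang2022LandauSiegel, (2.23)–(2.25); §2 (2.30)] -/
def member_wall004 (W : WallData) : BmultiDesign := .m3wall wall004Bulk wall004Bulk' W

/-- … is a member for every band datum. [cite: Zhang2022LandauSiegel, §7 Prop 7.1 (7.2)] -/
theorem kbmulti_wall004 (W : WallData) : KBmulti (member_wall004 W) := by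
  have h1 := kinkedProfile_kappaP (k := 3 / 2) (ν := 1) (by norm_num) le_rfl
  have h2 := kinkedProfile_kappaP (k := 5 / 2) (ν := 1 / 2) (by norm_num) (by norm_num)
  show KinkedProfile (fun y => kappaP 1 (3 / 2) y + kappaP (1 / 2) (5 / 2) y)
    (fun y => kappaP' 1 (3 / 2) y + kappaP' (1 / 2) (5 / 2) y)
  simpa only [one_mul] using h1.add_smul h2 1

/-! ### Part 4 — (L-a.iii) and M2: the far member and the two Λ members (v4 / v5 constructors) -/

/-- **multi-far-001** ((L-a.iii), v4 constructor `farBV`): the far block `𝟙_{[3/2,2)}` at top `P²` against the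
comparison length `P^{5/4}` (p4's `farBlock`, sup `1`, variation `≤ 2`); the design's bulk `i·ϰ(1,5/2)` vanishes on
`[1,2]` and its block height `1/2` is a homogeneity — declared narrowing. [cite: Zhang2022LandauSiegel, §7 (7.2); §8 Lemma 8.1] -/
def member_far001 (c' : ℝ) : BmultiDesign4 := .farBV ⟨c', 1, 1 / 4, 1, 2, farBlock⟩

/-- … is a member (`inClass_farBlock`). [cite: Zhang2022LandauSiegel, §7 (7.2); §8 Lemma 8.1] -/
theorem kbmulti_far001 (c' : ℝ) : KBmulti4 (member_far001 c') := inClass_farBlock c' (by norm_num) (by norm_num)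

/-- **multi-lambda-001** (M2; the intake's v5 constructor is `BmultiDesign5.m2 (d : LambdaDesign)`, membership
`familyLambdaBlockAll.InClass`) = p5's `lambdaDesignFeng1 c` (bulk `ϰ(63/125,3/2)`, piece `k = 1`, `ν = 63/125`, `P₂`).
[cite: Zhang2022LandauSiegel, §7 (7.2)] -/
def member_lambda001 (c : ℂ) : LambdaDesign := lambdaDesignFeng1 c

/-- **multi-lambda-002** (M2) = p5's `lambdaDesignFeng2 c` (piece `k = 2`, `P₃`). [cite: Zhang2022LandauSiegel, §7 (7.2)] -/
def member_lambda002 (c : ℂ) : LambdaDesign := lambdaDesignFeng2 c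

/-- … both are members of `familyLambdaBlockAll` (`inClass_lambdaDesignFeng`). [cite: Zhang2022LandauSiegel, §7 Prop 7.1 (7.2)] -/
theorem kbmulti_lambda001_002 (c : ℂ) :
    familyLambdaBlockAll.InClass (member_lambda001 c) ∧ familyLambdaBlockAll.InClass (member_lambda002 c) :=
  ⟨(inClass_lambdaDesignFeng c).1, (inClass_lambdaDesignFeng c).2⟩

/-- multi-lambda-001's LITERAL side-1 bulk `ϰ(63/125,3/2) + ϰ(1/2,5/2)` (both smooth side-1 pieces at `ι ≡ 1`).
[cite: Zhang2022LandauSiegel, (2.23)–(2.25)] -/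
def lambda001Bulk (y : ℝ) : ℂ := kappaP (63 / 125) (3 / 2) y + kappaP (1 / 2) (5 / 2) y

/-- its marked right derivative. [cite: Zhang2022LandauSiegel, (2.23)–(2.25)] -/
def lambda001Bulk' (y : ℝ) : ℂ := kappaP' (63 / 125) (3 / 2) y + kappaP' (1 / 2) (5 / 2) y

/-- multi-lambda-001 with its literal two-piece bulk: `⟨lambda001Bulk, lambda001Bulk', lambdaPieceFeng1, c⟩`.
[cite: Zhang2022LandauSiegel, §7 (7.2)] -/
def lambda001Design (c : ℂ) : LambdaDesign := ⟨lambda001Bulk, lambda001Bulk', lambdaPieceFeng1, c⟩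

/-- … is in class M2 (`familyLambdaBlockAll.InClass` = `LambdaDesign.InClass`), hence an `m2` member.
[cite: Zhang2022LandauSiegel, §7 Prop 7.1 (7.2)] -/
theorem kbmulti_lambda001_lit (c : ℂ) : (lambda001Design c).InClass := by
  have h1 := kinkedProfile_kappaP (k := 3 / 2) (ν := 63 / 125) (by norm_num) (by norm_num)
  have h2 := kinkedProfile_kappaP (k := 5 / 2) (ν := 1 / 2) (by norm_num) (by norm_num)
  have hk : KinkedProfile lambda001Bulk lambda001Bulk' := by
    show KinkedProfile (fun y => kappaP (63 / 125) (3 / 2) y + kappaP (1 / 2) (5 / 2) y)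
      (fun y => kappaP' (63 / 125) (3 / 2) y + kappaP' (1 / 2) (5 / 2) y)
    simpa only [one_mul] using h1.add_smul h2 1
  have hw : lambda001Bulk 1 = 0 := by
    show kappaP (63 / 125) (3 / 2) 1 + kappaP (1 / 2) (5 / 2) 1 = 0
    rw [kappaP_one (by norm_num) (by norm_num), kappaP_one (by norm_num) (by norm_num), add_zero]
  exact ⟨hk, hw, admissible_lambdaPieceFeng1⟩

/-! ### Part 5 — the verdicts of record follow by `familyBmulti…_decided` (nothing re-proved) -/

/-- Every v1 member above carries the word's verdict (`familyBmulti_decided`). [cite: Zhang2022LandauSiegel, §2 (2.32)–(2.33); §7 Prop 7.1 (7.2)] -/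
theorem verdicts_v1 (κ : ℝ → ℝ) (W : WallData) :
    VBmulti member_sanity001 ∧ VBmulti member_sanity002 ∧
      VBmulti (member_jump001 κ) ∧ VBmulti (member_jump002 κ) ∧ VBmulti (member_jump003 κ) ∧
      VBmulti (member_wall001 W) ∧ VBmulti (member_wall002 W) ∧ VBmulti (member_wall003 W) ∧
      VBmulti (member_wall004 W) :=
  ⟨familyBmulti_decided member_sanity001 kbmulti_sanity001, familyBmulti_decided member_sanity002 kbmulti_sanity002,
    familyBmulti_decided (member_jump001 κ) (kbmulti_jump001 κ),
    familyBmulti_decided (member_jump002 κ) (kbmulti_jump002 κ),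
    familyBmulti_decided (member_jump003 κ) (kbmulti_jump003 κ),
    familyBmulti_decided (member_wall001 W) (kbmulti_wall001 W),
    familyBmulti_decided (member_wall002 W) (kbmulti_wall002 W).1,
    familyBmulti_decided (member_wall003 W) (kbmulti_wall003 W),
    familyBmulti_decided (member_wall004 W) (kbmulti_wall004 W)⟩

/-- … and the v4 far member and the M2 members (`familyLambdaBlockAll_decided`).
[cite: Zhang2022LandauSiegel, §2 (2.32)–(2.33); §7 Prop 7.1 (7.2)] -/
theorem verdicts_v4 (c' : ℝ) (c : ℂ) :
    VBmulti4 (member_far001 c') ∧ familyLambdaBlockAll.Verdict (member_lambda001 c) ∧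
      familyLambdaBlockAll.Verdict (member_lambda002 c) ∧ familyLambdaBlockAll.Verdict (lambda001Design c) :=
  ⟨familyBmulti4_decided (member_far001 c') (kbmulti_far001 c'),
    familyLambdaBlockAll_decided (member_lambda001 c) (kbmulti_lambda001_002 c).1,
    familyLambdaBlockAll_decided (member_lambda002 c) (kbmulti_lambda001_002 c).2,
    familyLambdaBlockAll_decided (lambda001Design c) (kbmulti_lambda001_lit c)⟩

end Repair

end Literature.NumberTheory.LFunctions.Zhang2022
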